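import Summits.RiemannHypothesis.RiemannHypothesis.Theorems.S2FormatCColumnTwo
import Summits.RiemannHypothesis.RiemannHypothesis.Theorems.WeilFormatCTailEven
import Summits.RiemannHypothesis.RiemannHypothesis.Theorems.WeilFormatCTailOdd
import HarnessLib

/-!
# Format C at `S = {∞, 2}` — L-C3b ORDER 1 for the semilocal kernel: the explicit TAIL majorants `U₂^±`
# (hypothesis `hU₂` of weil-10's `sum_range_mul_mul_nonneg_of_certificate_sum_split`) for `S2FormatC.gram b`

Seat cc-s2-4 gen4 (`HOME/cc-s2-4/CC4-LEAN.md` §10).  weil-10's `WeilFormatCTailEven.lean` / `WeilFormatCTailOdd.lean` turn the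
order-1 column structure of the FULL kernel `gramCoeff a` into the explicit rank-one-plus-diagonal tail matrices `U₂⁺`, `U₂⁻`.
Their argument uses nothing about the kernel except the column estimate, so it is recorded here ONCE in generic form and then
instantiated for the `{∞,2}` kernel with the column lemmas of `S2FormatCColumnTwo.lean`:

* `evenTail_majorant_of_col` — rows `i < B`, tail modes `m ∈ Ico B₃ N` (`2 ≤ B₃`), any column function `bcol` with
  `|bcol m i − (−1)^{i+m} g_m/(4m)| ≤ κ_i/m²` on `m ≥ B₃` and `|g_m| ≤ G`, weights `0 < d₀ ≤ d_m` on `m ≥ B₃`, `θ > 0`: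
  `Σ_m (Σ_i bcol_m(i) x_i)²/d_m ≤ (1+θ)(G/4)²/(d₀(B₃−1))·(Σ_i (−1)^i x_i)² + (1+θ⁻¹)·B/(d₀B₃²(B₃−1))·Σ_i κ_i² x_i²`;
* `oddTail_majorant_of_col` — kernel indices `k < B`, `l ∈ Ico B₃ N` (`1 ≤ B₃`), `|bcol l k − (−1)^{k+l+2} V_k/(l+1)| ≤ κ_k/(l+1)²`:
  `Σ_l (Σ_k bcol_l(k) x_k)²/d_l ≤ (1+θ)/(d₀B₃)·(Σ_k (−1)^{k+1}V_k x_k)² + (1+θ⁻¹)·B/(d₀(B₃+1)²B₃)·Σ_k κ_k² x_k²`;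
* **`gram_even_tail_majorant_matrix`** / **`gram_odd_tail_majorant_matrix`** (`0 < b`, `2B ≤ B₃`) — the `{∞,2}` instances in
  the matrix shape `xᵀU₂x`: weil-10's `even/odd_tail_majorant_matrix` with `G = gram b`, `Φ₂ = (1 + (4/π)Λ)/4`,
  `κ⁺₂(i) = s²b/π² + 2iΛ/π + i/2 + 8b(1+E)/(3π²)`, `v⁻₂`, `κ⁻₂(i) = s²b²/(4π³) + 2iΛ/π + i/2 + 4b(1+E)/(3π²)`
  (`Λ = S2FormatC.lam`, `E = weilArchDensity (2b)`, `s² = (e^{b/2} − e^{−b/2})²`).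

With `S2FormatCFarTwo.lean` (L-C3a) this leaves, for an order-1 `{∞,2}` kernel rung, only DATA: `0 < d̂(B)`-type values, the
enclosed columns `B ≤ m < B₃` and the block certificate (sequel `S2FormatCDataRungTwo.lean`).  Standard axioms; no definitions;
no claim about RH.
-/

set_option linter.dupNamespace false
set_option autoImplicit false

noncomputable section

open Complex Set Finset Matrix
open scoped Real BigOperators

namespace Summit.RiemannHypothesis.RiemannHypothesis.Theorems.S2FormatC

open Literature.NumberTheory.LFunctions Literature.Analysis.SpecialFunctions
open Literature.NumberTheory.LFunctions.Yoshida1992 (freq polarCoeff incrCoeff archCoeff archExpSumSin)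
open Summit.RiemannHypothesis.RiemannHypothesis.Theorems.WeilFormatC

/-! ## Generic order-1 tail majorants (the kernel enters only through its column estimate) -/

section Generic

/-- **Even order-1 tail majorant, generic.**  See the module docstring. -/
theorem evenTail_majorant_of_col {B B₃ : ℕ} (hB₃ : 2 ≤ B₃) (bcol : ℕ → Fin B → ℝ) (g : ℕ → ℝ) {G : ℝ}
    (hg : ∀ m, |g m| ≤ G) (κ : Fin B → ℝ)
    (hcol : ∀ m, B₃ ≤ m → ∀ i : Fin B,
      |bcol m i - (-1 : ℝ) ^ (((i : ℕ) : ℤ) + m) * g m / (4 * m)| ≤ κ i / (m : ℝ) ^ 2)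
    (d : ℕ → ℝ) {d₀ : ℝ} (hd₀ : 0 < d₀) (hd : ∀ m, B₃ ≤ m → d₀ ≤ d m) {θ : ℝ} (hθ : 0 < θ)
    (N : ℕ) (x : Fin B → ℝ) :
    ∑ m ∈ Finset.Ico B₃ N, (∑ i : Fin B, bcol m i * x i) ^ 2 / d m
      ≤ (1 + θ) * (G / 4) ^ 2 / (d₀ * ((B₃ - 1 : ℕ) : ℝ)) * (∑ i : Fin B, (-1 : ℝ) ^ (i : ℕ) * x i) ^ 2
        + (1 + θ⁻¹) * (B / (d₀ * ((B₃ : ℝ) ^ 2 * ((B₃ - 1 : ℕ) : ℝ)))) * ∑ i : Fin B, κ i ^ 2 * x i ^ 2 := by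
  set T := Finset.Ico B₃ N with hT
  set Φ : ℝ := G / 4 with hΦ
  set φ : Fin 1 → ℕ → ℝ := fun _ m ↦ (-1 : ℝ) ^ m * g m / (4 * m) with hφ
  set v : Fin 1 → Fin B → ℝ := fun _ i ↦ (-1 : ℝ) ^ (i : ℕ) with hv
  set r : ℕ → Fin B → ℝ := fun m i ↦ bcol m i - ∑ e : Fin 1, v e i * φ e m with hr
  have hTm : ∀ m ∈ T, B₃ ≤ m := fun m hm ↦ (Finset.mem_Ico.mp hm).1
  have hw : ∀ m ∈ T, 0 ≤ 1 / d m := fun m hm ↦ by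
    have := hd m (hTm m hm); have : 0 < d m := lt_of_lt_of_le hd₀ this; positivity
  have hb : ∀ m ∈ T, ∀ i, bcol m i = (∑ e : Fin 1, v e i * φ e m) + r m i := fun m _ i ↦ by
    simp only [hr]; ring
  have hrb : ∀ m ∈ T, ∀ i : Fin B, |r m i| ≤ κ i * (1 / (m : ℝ) ^ 2) := by
    intro m hm i
    have h := hcol m (hTm m hm) i
    have e : r m i = bcol m i - (-1 : ℝ) ^ (((i : ℕ) : ℤ) + m) * g m / (4 * m) := by
      simp only [hr, hv, hφ, Finset.univ_unique, Fin.default_eq_zero, Finset.sum_singleton]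
      rw [show (((i : ℕ) : ℤ) + (m : ℤ)) = (((i : ℕ) + m : ℕ) : ℤ) by push_cast; ring, zpow_natCast, pow_add]
      ring
    rw [e]
    refine h.trans (le_of_eq ?_)
    ring
  have hmaj := tailMajorant T bcol r v φ (fun m ↦ 1 / d m) (fun m ↦ 1 / (m : ℝ) ^ 2) κ x hθ hw hb hrb
  -- simplify the `Fin 1` sums and the weights
  simp only [Finset.univ_unique, Fin.default_eq_zero, Finset.sum_singleton, Fintype.card_fin] at hmaj
  have hlhs : ∑ m ∈ T, (∑ i : Fin B, bcol m i * x i) ^ 2 / d m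
      = ∑ m ∈ T, 1 / d m * (∑ i : Fin B, bcol m i * x i) ^ 2 :=
    Finset.sum_congr rfl fun m _ ↦ by ring
  rw [hlhs]
  refine hmaj.trans ?_
  -- bound the two tail sums
  have hF : ∑ m ∈ T, 1 / d m * φ 0 m * φ 0 m ≤ Φ ^ 2 / (d₀ * ((B₃ - 1 : ℕ) : ℝ)) := by
    have hterm : ∀ m ∈ T, 1 / d m * φ 0 m * φ 0 m ≤ Φ ^ 2 / d₀ * (1 / (m : ℝ) ^ 2) := by
      intro m hm
      have hdm := hd m (hTm m hm)
      have hdm0 : 0 < d m := lt_of_lt_of_le hd₀ hdm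
      have hm0 : (0 : ℝ) < m := by exact_mod_cast (show 0 < m by have := hTm m hm; omega)
      have hgm := hg m
      have hφabs : |φ 0 m| ≤ Φ / m := by
        simp only [hφ]
        rw [abs_div, abs_mul, abs_of_pos (by positivity : (0 : ℝ) < 4 * m)]
        have h1 : |(-1 : ℝ) ^ m| = 1 := by rw [abs_pow, abs_neg, abs_one, one_pow]
        rw [h1, one_mul, hΦ]
        rw [div_le_div_iff₀ (by positivity) hm0]
        nlinarith [hgm, hm0]
      have hsq : φ 0 m * φ 0 m ≤ (Φ / m) ^ 2 := by
        have := sq_abs (φ 0 m)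
        nlinarith [hφabs, abs_nonneg (φ 0 m), sq_nonneg (|φ 0 m| - Φ / m)]
      calc 1 / d m * φ 0 m * φ 0 m = 1 / d m * (φ 0 m * φ 0 m) := by ring
        _ ≤ 1 / d₀ * (Φ / m) ^ 2 := by
            refine mul_le_mul (one_div_le_one_div_of_le hd₀ hdm) hsq
              (mul_self_nonneg _) (by positivity)
        _ = Φ ^ 2 / d₀ * (1 / (m : ℝ) ^ 2) := by
            field_simp
    refine (Finset.sum_le_sum hterm).trans ?_
    rw [← Finset.mul_sum]
    have hΦ2 : 0 ≤ Φ ^ 2 / d₀ := by positivity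
    calc Φ ^ 2 / d₀ * ∑ m ∈ T, 1 / (m : ℝ) ^ 2 ≤ Φ ^ 2 / d₀ * (1 / ((B₃ - 1 : ℕ) : ℝ)) :=
          mul_le_mul_of_nonneg_left (sum_Ico_inv_sq_le hB₃ N) hΦ2
      _ = Φ ^ 2 / (d₀ * ((B₃ - 1 : ℕ) : ℝ)) := by rw [div_mul_div_comm, mul_one]
  have hG : ∑ m ∈ T, 1 / d m * (1 / (m : ℝ) ^ 2) ^ 2 ≤ 1 / (d₀ * ((B₃ : ℝ) ^ 2 * ((B₃ - 1 : ℕ) : ℝ))) := by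
    have hterm : ∀ m ∈ T, 1 / d m * (1 / (m : ℝ) ^ 2) ^ 2 ≤ 1 / d₀ * (1 / (m : ℝ) ^ 4) := by
      intro m hm
      have hdm := hd m (hTm m hm)
      have e : (1 / (m : ℝ) ^ 2) ^ 2 = 1 / (m : ℝ) ^ 4 := by rw [_root_.one_div_pow, ← pow_mul]
      rw [e]
      exact mul_le_mul_of_nonneg_right (one_div_le_one_div_of_le hd₀ hdm) (by positivity)
    refine (Finset.sum_le_sum hterm).trans ?_
    rw [← Finset.mul_sum]
    calc 1 / d₀ * ∑ m ∈ T, 1 / (m : ℝ) ^ 4 ≤ 1 / d₀ * (1 / (((B₃ : ℝ) ^ 2) * ((B₃ - 1 : ℕ) : ℝ))) :=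
          mul_le_mul_of_nonneg_left (sum_Ico_inv_pow_four_le hB₃ N) (by positivity)
      _ = 1 / (d₀ * ((B₃ : ℝ) ^ 2 * ((B₃ - 1 : ℕ) : ℝ))) := by rw [one_div_mul_one_div]
  -- assemble
  have hsq0 : 0 ≤ (∑ i : Fin B, v 0 i * x i) * (∑ i : Fin B, v 0 i * x i) := mul_self_nonneg _
  have hρ0 : 0 ≤ (B : ℝ) * ∑ i : Fin B, κ i ^ 2 * x i ^ 2 := by
    have : 0 ≤ ∑ i : Fin B, κ i ^ 2 * x i ^ 2 := Finset.sum_nonneg fun i _ ↦ by positivity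
    positivity
  have h1 : (1 + θ) * ((∑ m ∈ T, 1 / d m * φ 0 m * φ 0 m)
        * ((∑ i : Fin B, v 0 i * x i) * (∑ i : Fin B, v 0 i * x i)))
      ≤ (1 + θ) * (Φ ^ 2 / (d₀ * ((B₃ - 1 : ℕ) : ℝ))
        * ((∑ i : Fin B, v 0 i * x i) * (∑ i : Fin B, v 0 i * x i))) :=
    mul_le_mul_of_nonneg_left (mul_le_mul_of_nonneg_right hF hsq0) (by positivity)
  have h2 : (1 + θ⁻¹) * (∑ m ∈ T, 1 / d m * (1 / (m : ℝ) ^ 2) ^ 2) * ((B : ℝ) * ∑ i : Fin B, κ i ^ 2 * x i ^ 2)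
      ≤ (1 + θ⁻¹) * (1 / (d₀ * ((B₃ : ℝ) ^ 2 * ((B₃ - 1 : ℕ) : ℝ))))
          * ((B : ℝ) * ∑ i : Fin B, κ i ^ 2 * x i ^ 2) := by
    have hθ1 : 0 ≤ 1 + θ⁻¹ := by positivity
    exact mul_le_mul_of_nonneg_right (mul_le_mul_of_nonneg_left hG hθ1) hρ0
  refine (add_le_add h1 h2).trans (le_of_eq ?_)
  simp only [hv]
  rw [← sq]
  ring

/-- **Odd order-1 tail majorant, generic** (kernel index `k` = mode `k+1`, tail index `l` = mode `l+1`).  See the module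
docstring. -/
theorem oddTail_majorant_of_col {B B₃ : ℕ} (hB₃ : 1 ≤ B₃) (bcol : ℕ → Fin B → ℝ) (V κ : Fin B → ℝ)
    (hcol : ∀ l, B₃ ≤ l → ∀ k : Fin B,
      |bcol l k - (-1 : ℝ) ^ ((((k : ℕ) + 1 : ℕ) : ℤ) + ((l + 1 : ℕ) : ℤ)) * V k / ((l + 1 : ℕ) : ℝ)|
        ≤ κ k / (((l + 1 : ℕ) : ℝ)) ^ 2)
    (d : ℕ → ℝ) {d₀ : ℝ} (hd₀ : 0 < d₀) (hd : ∀ l, B₃ ≤ l → d₀ ≤ d l) {θ : ℝ} (hθ : 0 < θ)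
    (N : ℕ) (x : Fin B → ℝ) :
    ∑ l ∈ Finset.Ico B₃ N, (∑ k : Fin B, bcol l k * x k) ^ 2 / d l
      ≤ (1 + θ) * (1 / (d₀ * B₃)) * (∑ k : Fin B, ((-1 : ℝ) ^ ((k : ℕ) + 1) * V k) * x k) ^ 2
        + (1 + θ⁻¹) * (B / (d₀ * ((((B₃ : ℝ) + 1) ^ 2) * (B₃ : ℝ)))) * ∑ k : Fin B, κ k ^ 2 * x k ^ 2 := by
  set T := Finset.Ico B₃ N with hT
  set φ : Fin 1 → ℕ → ℝ := fun _ l ↦ (-1 : ℝ) ^ (l + 1) / ((l : ℝ) + 1) with hφ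
  set v : Fin 1 → Fin B → ℝ := fun _ k ↦ (-1 : ℝ) ^ ((k : ℕ) + 1) * V k with hv
  set r : ℕ → Fin B → ℝ := fun l k ↦ bcol l k - ∑ e : Fin 1, v e k * φ e l with hr
  have hTl : ∀ l ∈ T, B₃ ≤ l := fun l hl ↦ (Finset.mem_Ico.mp hl).1
  have hw : ∀ l ∈ T, 0 ≤ 1 / d l := fun l hl ↦ by
    have := hd l (hTl l hl); have : 0 < d l := lt_of_lt_of_le hd₀ this; positivity
  have hb : ∀ l ∈ T, ∀ k, bcol l k = (∑ e : Fin 1, v e k * φ e l) + r l k := fun l _ k ↦ by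
    simp only [hr]; ring
  have hrb : ∀ l ∈ T, ∀ k : Fin B, |r l k| ≤ κ k * (1 / ((l : ℝ) + 1) ^ 2) := by
    intro l hl k
    have h := hcol l (hTl l hl) k
    have e : r l k = bcol l k - (-1 : ℝ) ^ ((((k : ℕ) + 1 : ℕ) : ℤ) + ((l + 1 : ℕ) : ℤ)) * V k / ((l + 1 : ℕ) : ℝ) := by
      simp only [hr, hv, hφ, Finset.univ_unique, Fin.default_eq_zero, Finset.sum_singleton]
      rw [show ((((k : ℕ) + 1 : ℕ) : ℤ) + ((l + 1 : ℕ) : ℤ)) = ((((k : ℕ) + 1) + (l + 1) : ℕ) : ℤ) by push_cast; ring,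
        zpow_natCast, pow_add]
      push_cast
      ring
    rw [e]
    refine h.trans (le_of_eq ?_)
    push_cast
    ring
  have hmaj := tailMajorant T bcol r v φ (fun l ↦ 1 / d l) (fun l ↦ 1 / ((l : ℝ) + 1) ^ 2) κ x hθ hw hb hrb
  simp only [Finset.univ_unique, Fin.default_eq_zero, Finset.sum_singleton, Fintype.card_fin] at hmaj
  have hlhs : ∑ l ∈ T, (∑ k : Fin B, bcol l k * x k) ^ 2 / d l
      = ∑ l ∈ T, 1 / d l * (∑ k : Fin B, bcol l k * x k) ^ 2 :=
    Finset.sum_congr rfl fun l _ ↦ by ring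
  rw [hlhs]
  refine hmaj.trans ?_
  -- tail sums
  have hF : ∑ l ∈ T, 1 / d l * φ 0 l * φ 0 l ≤ 1 / (d₀ * B₃) := by
    have hterm : ∀ l ∈ T, 1 / d l * φ 0 l * φ 0 l ≤ 1 / d₀ * (1 / ((l : ℝ) + 1) ^ 2) := by
      intro l hl
      have hdl := hd l (hTl l hl)
      have hsq : φ 0 l * φ 0 l = 1 / ((l : ℝ) + 1) ^ 2 := by
        simp only [hφ]
        rw [div_mul_div_comm, ← sq, ← pow_mul, Nat.mul_comm, pow_mul, neg_one_sq, one_pow, sq]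
      rw [mul_assoc, hsq]
      exact mul_le_mul_of_nonneg_right (one_div_le_one_div_of_le hd₀ hdl) (by positivity)
    refine (Finset.sum_le_sum hterm).trans ?_
    rw [← Finset.mul_sum]
    calc 1 / d₀ * ∑ l ∈ T, 1 / ((l : ℝ) + 1) ^ 2 ≤ 1 / d₀ * (1 / (B₃ : ℝ)) :=
          mul_le_mul_of_nonneg_left (sum_Ico_inv_succ_sq_le hB₃ N) (by positivity)
      _ = 1 / (d₀ * B₃) := by rw [one_div_mul_one_div]
  have hG : ∑ l ∈ T, 1 / d l * (1 / ((l : ℝ) + 1) ^ 2) ^ 2 ≤ 1 / (d₀ * ((((B₃ : ℝ) + 1) ^ 2) * (B₃ : ℝ))) := by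
    have hterm : ∀ l ∈ T, 1 / d l * (1 / ((l : ℝ) + 1) ^ 2) ^ 2 ≤ 1 / d₀ * (1 / ((l : ℝ) + 1) ^ 4) := by
      intro l hl
      have hdl := hd l (hTl l hl)
      have e : (1 / ((l : ℝ) + 1) ^ 2) ^ 2 = 1 / ((l : ℝ) + 1) ^ 4 := by rw [_root_.one_div_pow, ← pow_mul]
      rw [e]
      exact mul_le_mul_of_nonneg_right (one_div_le_one_div_of_le hd₀ hdl) (by positivity)
    refine (Finset.sum_le_sum hterm).trans ?_
    rw [← Finset.mul_sum]
    calc 1 / d₀ * ∑ l ∈ T, 1 / ((l : ℝ) + 1) ^ 4 ≤ 1 / d₀ * (1 / ((((B₃ : ℝ) + 1) ^ 2) * (B₃ : ℝ))) :=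
          mul_le_mul_of_nonneg_left (sum_Ico_inv_succ_pow_four_le hB₃ N) (by positivity)
      _ = 1 / (d₀ * ((((B₃ : ℝ) + 1) ^ 2) * (B₃ : ℝ))) := by rw [one_div_mul_one_div]
  have hsq0 : 0 ≤ (∑ k : Fin B, v 0 k * x k) * (∑ k : Fin B, v 0 k * x k) := mul_self_nonneg _
  have hρ0 : 0 ≤ (B : ℝ) * ∑ k : Fin B, κ k ^ 2 * x k ^ 2 := by
    have : 0 ≤ ∑ k : Fin B, κ k ^ 2 * x k ^ 2 := Finset.sum_nonneg fun k _ ↦ by positivity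
    positivity
  have h1 : (1 + θ) * ((∑ l ∈ T, 1 / d l * φ 0 l * φ 0 l)
        * ((∑ k : Fin B, v 0 k * x k) * (∑ k : Fin B, v 0 k * x k)))
      ≤ (1 + θ) * (1 / (d₀ * B₃) * ((∑ k : Fin B, v 0 k * x k) * (∑ k : Fin B, v 0 k * x k))) :=
    mul_le_mul_of_nonneg_left (mul_le_mul_of_nonneg_right hF hsq0) (by positivity)
  have h2 : (1 + θ⁻¹) * (∑ l ∈ T, 1 / d l * (1 / ((l : ℝ) + 1) ^ 2) ^ 2) * ((B : ℝ) * ∑ k : Fin B, κ k ^ 2 * x k ^ 2)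
      ≤ (1 + θ⁻¹) * (1 / (d₀ * ((((B₃ : ℝ) + 1) ^ 2) * (B₃ : ℝ))))
          * ((B : ℝ) * ∑ k : Fin B, κ k ^ 2 * x k ^ 2) := by
    have hθ1 : 0 ≤ 1 + θ⁻¹ := by positivity
    exact mul_le_mul_of_nonneg_right (mul_le_mul_of_nonneg_left hG hθ1) hρ0
  refine (add_le_add h1 h2).trans (le_of_eq ?_)
  simp only [hv]
  rw [← sq]
  ring

end Generic

/-! ## The `{∞,2}` instances in matrix shape -/

section Two

variable {b : ℝ}

/-- `|g₂(m)| ≤ 1 + (4/π)Λ` for `g₂(m) = 1 + (4/π)Λ sin(ω_m log 2)`. -/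
theorem abs_gTwo_le (b : ℝ) (m : ℤ) :
    |1 + 4 / π * (lam * Real.sin (freq b m * Real.log 2))| ≤ 1 + 4 / π * lam := by
  have hs : |lam * Real.sin (freq b m * Real.log 2)| ≤ lam := by
    rw [abs_mul, abs_of_nonneg lam_nonneg]
    exact (mul_le_mul_of_nonneg_left (Real.abs_sin_le_one _) lam_nonneg).trans (le_of_eq (mul_one _))
  have h4 : (0 : ℝ) ≤ 4 / π := by positivity
  calc |1 + 4 / π * (lam * Real.sin (freq b m * Real.log 2))|
      ≤ |(1 : ℝ)| + |4 / π * (lam * Real.sin (freq b m * Real.log 2))| := abs_add_le _ _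
    _ ≤ 1 + 4 / π * lam := by
        rw [abs_one, abs_mul, abs_of_nonneg h4]
        exact add_le_add le_rfl (mul_le_mul_of_nonneg_left hs h4)

/-- **`hU₂` for the `{∞,2}` kernel, even sector** (`0 < b`, `2B ≤ B₃`, `2 ≤ B₃`, `0 < d₀ ≤ d_m` on `m ≥ B₃`, `θ > 0`):
`Σ_{m∈Ico B₃ N} (Σ_i M⁺_{gram b}(i,m) x_i)²/d_m ≤ xᵀU₂⁺x` with
`U₂⁺ = (1+θ)Φ₂²/(d₀(B₃−1))·vvᵀ + (1+θ⁻¹)B/(d₀B₃²(B₃−1))·diag(κ⁺₂²)`, `v_i = (−1)^i`, `Φ₂ = (1 + (4/π)Λ)/4`. -/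
theorem gram_even_tail_majorant_matrix (hb : 0 < b) {B B₃ : ℕ} (hBB : 2 * B ≤ B₃) (hB₃ : 2 ≤ B₃)
    (d : ℕ → ℝ) {d₀ : ℝ} (hd₀ : 0 < d₀) (hd : ∀ m, B₃ ≤ m → d₀ ≤ d m) {θ : ℝ} (hθ : 0 < θ)
    (N : ℕ) (x : Fin B → ℝ) :
    ∑ m ∈ Finset.Ico B₃ N, (∑ i : Fin B,
        (if (i : ℕ) = 0 then gram b 0 m else if m = 0 then gram b i 0
          else (gram b i m + gram b i (-(m : ℤ))) / 2) * x i) ^ 2 / d m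
      ≤ x ⬝ᵥ (Matrix.of fun i j : Fin B ↦
          (1 + θ) * ((1 + 4 / π * lam) / 4) ^ 2 / (d₀ * ((B₃ - 1 : ℕ) : ℝ)) * ((-1 : ℝ) ^ (i : ℕ) * (-1 : ℝ) ^ (j : ℕ))
            + (if i = j then (1 + θ⁻¹) * (B / (d₀ * ((B₃ : ℝ) ^ 2 * ((B₃ - 1 : ℕ) : ℝ))))
                * ((Real.exp (b / 2) - Real.exp (-(b / 2))) ^ 2 * b / π ^ 2
                  + 2 * (i : ℕ) * lam / π
                  + (((i : ℕ) : ℝ) / 2 + 8 * b * (1 + weilArchDensity (2 * b)) / (3 * π ^ 2))) ^ 2 else 0)) *ᵥ x := by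
  have hcol : ∀ m, B₃ ≤ m → ∀ i : Fin B,
      |(fun (m : ℕ) (i : Fin B) ↦ (if (i : ℕ) = 0 then gram b 0 m else if m = 0 then gram b i 0
          else (gram b i m + gram b i (-(m : ℤ))) / 2)) m i
        - (-1 : ℝ) ^ (((i : ℕ) : ℤ) + m) * (fun m : ℕ ↦ 1 + 4 / π * (lam * Real.sin (freq b m * Real.log 2))) m
          / (4 * m)|
        ≤ (fun i : Fin B ↦ (Real.exp (b / 2) - Real.exp (-(b / 2))) ^ 2 * b / π ^ 2 + 2 * (i : ℕ) * lam / π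
            + (((i : ℕ) : ℝ) / 2 + 8 * b * (1 + weilArchDensity (2 * b)) / (3 * π ^ 2))) i / (m : ℝ) ^ 2 := by
    intro m hm i
    have hm1 : 1 ≤ m := by omega
    have h2i : 2 * (i : ℕ) ≤ m := by have := i.isLt; omega
    exact abs_gramEvenKernel_col_sub_le hb hm1 h2i
  have h := evenTail_majorant_of_col hB₃ _ _ (fun m ↦ abs_gTwo_le b m) _ hcol d hd₀ hd hθ N x
  refine h.trans (le_of_eq ?_)
  rw [dotProduct_rankOne_add_diag_mulVec]

/-- **`hU₂` for the `{∞,2}` kernel, odd sector** (`0 < b`, `2B ≤ B₃`, `1 ≤ B₃`, `0 < d₀ ≤ d_l` on `l ≥ B₃`, `θ > 0`):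
`Σ_{l∈Ico B₃ N} (Σ_k M⁻_{gram b}(k,l) x_k)²/d_l ≤ xᵀU₂⁻x` with
`U₂⁻ = (1+θ)/(d₀B₃)·vvᵀ + (1+θ⁻¹)B/(d₀(B₃+1)²B₃)·diag(κ⁻₂²)`, `v_k = (−1)^{k+1}v⁻₂(k+1)`. -/
theorem gram_odd_tail_majorant_matrix (hb : 0 < b) {B B₃ : ℕ} (hBB : 2 * B ≤ B₃) (hB₃ : 1 ≤ B₃)
    (d : ℕ → ℝ) {d₀ : ℝ} (hd₀ : 0 < d₀) (hd : ∀ l, B₃ ≤ l → d₀ ≤ d l) {θ : ℝ} (hθ : 0 < θ)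
    (N : ℕ) (x : Fin B → ℝ) :
    ∑ l ∈ Finset.Ico B₃ N, (∑ k : Fin B,
        ((gram b (((k : ℕ) : ℤ) + 1) ((l : ℤ) + 1) - gram b (((k : ℕ) : ℤ) + 1) (-((l : ℤ) + 1))) / 2)
          * x k) ^ 2 / d l
      ≤ x ⬝ᵥ (Matrix.of fun k k' : Fin B ↦
          (1 + θ) * (1 / (d₀ * B₃)) *
            (((-1 : ℝ) ^ ((k : ℕ) + 1) *
              (-(4 * (Real.exp (b / 2) - Real.exp (-(b / 2))) ^ 2
                    * (freq b (((k : ℕ) : ℤ) + 1) / (1 + 4 * freq b (((k : ℕ) : ℤ) + 1) ^ 2)) / π)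
                - lam * Real.sin (freq b (((k : ℕ) : ℤ) + 1) * Real.log 2) / π
                - (Complex.digamma (1 / 4 + ((freq b (((k : ℕ) : ℤ) + 1) : ℝ) : ℂ) / 2 * I)).im / (2 * π)
                + archExpSumSin b (((k : ℕ) : ℤ) + 1) / π))
              * ((-1 : ℝ) ^ ((k' : ℕ) + 1) *
              (-(4 * (Real.exp (b / 2) - Real.exp (-(b / 2))) ^ 2
                    * (freq b (((k' : ℕ) : ℤ) + 1) / (1 + 4 * freq b (((k' : ℕ) : ℤ) + 1) ^ 2)) / π)
                - lam * Real.sin (freq b (((k' : ℕ) : ℤ) + 1) * Real.log 2) / π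
                - (Complex.digamma (1 / 4 + ((freq b (((k' : ℕ) : ℤ) + 1) : ℝ) : ℂ) / 2 * I)).im / (2 * π)
                + archExpSumSin b (((k' : ℕ) : ℤ) + 1) / π)))
          + (if k = k' then (1 + θ⁻¹) * (B / (d₀ * ((((B₃ : ℝ) + 1) ^ 2) * (B₃ : ℝ))))
              * ((Real.exp (b / 2) - Real.exp (-(b / 2))) ^ 2 * b ^ 2 / (4 * π ^ 3)
                + 2 * ((k : ℕ) + 1 : ℕ) * lam / π
                + ((((k : ℕ) + 1 : ℕ) : ℝ) / 2 + 4 * b * (1 + weilArchDensity (2 * b)) / (3 * π ^ 2))) ^ 2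
            else 0)) *ᵥ x := by
  set V : Fin B → ℝ := fun k ↦
    -(4 * (Real.exp (b / 2) - Real.exp (-(b / 2))) ^ 2
        * (freq b (((k : ℕ) : ℤ) + 1) / (1 + 4 * freq b (((k : ℕ) : ℤ) + 1) ^ 2)) / π)
      - lam * Real.sin (freq b (((k : ℕ) : ℤ) + 1) * Real.log 2) / π
      - (Complex.digamma (1 / 4 + ((freq b (((k : ℕ) : ℤ) + 1) : ℝ) : ℂ) / 2 * I)).im / (2 * π)
      + archExpSumSin b (((k : ℕ) : ℤ) + 1) / π with hV
  set κ : Fin B → ℝ := fun k ↦ (Real.exp (b / 2) - Real.exp (-(b / 2))) ^ 2 * b ^ 2 / (4 * π ^ 3)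
      + 2 * ((k : ℕ) + 1 : ℕ) * lam / π
      + ((((k : ℕ) + 1 : ℕ) : ℝ) / 2 + 4 * b * (1 + weilArchDensity (2 * b)) / (3 * π ^ 2)) with hκ
  set bcol : ℕ → Fin B → ℝ := fun l k ↦
    (gram b (((k : ℕ) : ℤ) + 1) ((l : ℤ) + 1) - gram b (((k : ℕ) : ℤ) + 1) (-((l : ℤ) + 1))) / 2 with hbcol
  have hcol : ∀ l, B₃ ≤ l → ∀ k : Fin B,
      |bcol l k - (-1 : ℝ) ^ ((((k : ℕ) + 1 : ℕ) : ℤ) + ((l + 1 : ℕ) : ℤ)) * V k / ((l + 1 : ℕ) : ℝ)|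
        ≤ κ k / (((l + 1 : ℕ) : ℝ)) ^ 2 := by
    intro l hl k
    have hi1 : 1 ≤ (k : ℕ) + 1 := by omega
    have h2i : 2 * ((k : ℕ) + 1) ≤ l + 1 := by have := k.isLt; omega
    have h := abs_gramOddKernel_col_sub_le hb hi1 h2i
    rw [hbcol, hV, hκ]
    refine le_of_eq_of_le ?_ h
    push_cast
    rfl
  have h := oddTail_majorant_of_col hB₃ bcol V κ hcol d hd₀ hd hθ N x
  refine h.trans (le_of_eq ?_)
  rw [dotProduct_rankOne_add_diag_mulVec]

end Two

end Summit.RiemannHypothesis.RiemannHypothesis.Theorems.S2FormatC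

end
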